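/-
COR-CM (cell pub-hodgecm2 = stage 2 of the Hodge ladder), seat b26 gen 16 (prover-pub-hodgecm2-b26-g16-0, 2026-08-21);
count-neutral for the binder table (no row).  Sequel of `Geometry/WeightOneHodgeStructureOfPeriod` (gen 15): `End(V¹_τ)`
when the period `τ` DOES satisfy a rational quadratic equation.  Theorems only: no definition, no named fact, no instance.
-/
import Summits.HodgeConjecture.CorCM.Geometry.WeightOneHodgeStructureOfPeriod
import Mathlib.LinearAlgebra.Matrix.ToLin
import HarnessLib

/-!
# Endomorphisms of the weight-one Hodge structure of a period: complex multiplication iff `τ` is quadratic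

`Geometry/WeightOneHodgeStructureOfPeriod` builds, for a period vector `ω ∈ ℂ ⊗_ℚ ℚ²` with coordinates `(1, τ)`, the
weight-one `ℚ`-Hodge structure `V¹_τ = ofSplitting (ℂ ∙ ω) hP one_pos` on `ℚ²` (`F¹ = ℂ ω`; the `H¹` of `ℂ/(ℤ + τℤ)`,
Lange–Birkenhake Thm. 4.2.1) and proves `End(V¹_τ) = ℚ` when `τ` satisfies NO rational quadratic equation
(Moonen–Zarhin 1999 §2, `g = 1`, Type I(1)).  This file does the complementary case, Type IV(1,1):
* §1 `map_F_le_iff_rel` — a `ℚ`-linear `M : ℚ² → ℚ²` underlies an endomorphism of `V¹_τ` iff `M_ℂ ω ∈ ℂ ω` iff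
  `m₀₁ τ² + (m₀₀ − m₁₁) τ − m₁₀ = 0` (`m_{ji} = (M eᵢ)_j`);
* §2 for `τ² + pτ + q = 0` (`p, q ∈ ℚ`) the map `M_τ = Matrix.toLin' !![0, 1; -q, -p]` (multiplication by `τ` in the
  basis `1, τ`) has `(M_τ)_ℂ ω = τ • ω`, so underlies an endomorphism of `V¹_τ` (`exists_hom_eq_cmMap`), is not a
  rational scalar, and `M_τ² + p M_τ + q = 0`;
* §3 `hom_eq_smul_add_smul_cmMap` — for such `τ ∉ ℝ` EVERY endomorphism is `x • 1 + y • M_τ`, and conversely: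
  **`End(V¹_τ) = ℚ[M_τ] ≅ ℚ[X]/(X² + pX + q) = ℚ(τ)`** (commutativity `hom_comm`);
* §4 `exists_hom_ne_smul_iff` — for `τ ∉ ℝ`: **a non-scalar endomorphism exists iff `a τ² + b τ + c = 0` for some
  rationals with `a ≠ 0`**; with gen 15's `hom_eq_smul` this is Moonen–Zarhin (2.1) for `g = 1` (Type I(1)
  `End⁰ = ℚ` versus Type IV(1,1) CM) read on the period — `ℂ/(ℤ + τℤ)` has complex multiplication iff `[ℚ(τ):ℚ] = 2`
  (Silverman AEC VI Thm. 5.5 for the lattice side, NOT used here);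
* §5 exports at the level of `τ` (`exists_weightOne_rankTwo_cm_of`, `…_sqrt_neg` for `τ = i√d`).
The abelian-variety reading (Riemann's theorem) is `Assembly/CMEllipticCurveOfPeriod`.

References: [MoonenZarhin1999LowDim] Math. Ann. 315 (1999), §2 (2.1) · [LangeBirkenhake1992] §1.2 Prop. 1.2.3,
Thm. 4.2.1 · [SilvermanAEC2009] VI Thm. 5.5 · [DeligneHodgeII1971] 1.2.5, 2.1.15.
-/

noncomputable section

open scoped TensorProduct
open Module TensorProduct
open Literature.AlgebraicGeometry.Motives
open Literature.AlgebraicGeometry.Motives.HodgeStructure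

namespace Summit.HodgeConjecture.CorCM.PeriodHodgeStructure

/-! ## §1 The endomorphism criterion in coordinates -/

section Period

variable {τ : ℂ} {ω : ℂ ⊗[ℚ] (Fin 2 → ℚ)} (h0 : piScalarRight ℚ ℂ ℂ (Fin 2) ω 0 = 1)
  (h1 : piScalarRight ℚ ℂ ℂ (Fin 2) ω 1 = τ)

include h0 h1 in
/-- The period vector is `ω = 1 ⊗ e₀ + τ ⊗ e₁`. [folklore] -/
theorem eq_tmul_add_tmul : ω = (1 : ℂ) ⊗ₜ[ℚ] (Pi.single 0 1 : Fin 2 → ℚ) + τ ⊗ₜ[ℚ] Pi.single 1 1 := by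
  apply (piScalarRight ℚ ℂ ℂ (Fin 2)).injective
  ext j
  rw [map_add, Pi.add_apply, coords_tmul, coords_tmul]
  fin_cases j
  · simpa using h0
  · simpa using h1

include h0 h1 in
/-- Coordinates of `M_ℂ ω` for a `ℚ`-linear `M : ℚ² → ℚ²`: `(M_ℂ ω)_j = (M e₀)_j + (M e₁)_j τ`. [folklore] -/
theorem coords_baseChange (M : (Fin 2 → ℚ) →ₗ[ℚ] (Fin 2 → ℚ)) (j : Fin 2) :
    piScalarRight ℚ ℂ ℂ (Fin 2) (M.baseChange ℂ ω) j =
      (M (Pi.single 0 1) j : ℂ) + (M (Pi.single 1 1) j : ℂ) * τ := by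
  rw [eq_tmul_add_tmul h0 h1, map_add, LinearMap.baseChange_tmul, LinearMap.baseChange_tmul, map_add,
    Pi.add_apply, coords_tmul, coords_tmul, mul_one]

include h0 h1 in
/-- Coordinates of `l • ω`: `(l, l τ)`. [folklore] -/
theorem coords_smul (l : ℂ) (j : Fin 2) :
    piScalarRight ℚ ℂ ℂ (Fin 2) (l • ω) j = if j = 0 then l else l * τ := by
  rw [map_smul, Pi.smul_apply, smul_eq_mul]
  fin_cases j
  · simp [h0]
  · simp [h1]

variable (hP : IsCompl (ℂ ∙ ω) (complexConj (ℂ ∙ ω)))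

/-- **A `ℚ`-linear map underlies an endomorphism of `V¹_τ` iff its complexification stabilises the line `ℂ ω`**
(`F⁰ = ⊤`, `F¹ = ℂ ω`, `F² = ⊥`). [cite: MoonenZarhin1999LowDim, §2 (g = 1)] -/
theorem map_F_le_iff_mem_span (M : (Fin 2 → ℚ) →ₗ[ℚ] (Fin 2 → ℚ)) :
    (∀ p : ℤ, ((ofSplitting (ℂ ∙ ω) hP one_pos : HodgeStructure (Fin 2 → ℚ) 1).F p).map (M.baseChange ℂ) ≤
        (ofSplitting (ℂ ∙ ω) hP one_pos : HodgeStructure (Fin 2 → ℚ) 1).F p) ↔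
      M.baseChange ℂ ω ∈ ℂ ∙ ω := by
  constructor
  · intro h
    have h1' := h 1
    rw [F_one hP] at h1'
    exact h1' ⟨ω, Submodule.mem_span_singleton_self _, rfl⟩
  · intro hω p
    by_cases hp : p ≤ 0
    · rw [ofSplitting_F, twoStepFiltration_of_le_zero _ hp]
      exact le_top
    by_cases hp1 : p = 1
    · subst hp1
      rw [F_one hP, Submodule.map_le_iff_le_comap, Submodule.span_singleton_le_iff_mem, Submodule.mem_comap]
      exact hω
    · rw [F_of_two_le hP (by omega), Submodule.map_bot]

include h0 h1 in
/-- **The endomorphism criterion in coordinates**: `M_ℂ ω ∈ ℂ ω` iff the matrix entries `m_{ji} = (M eᵢ)_j` satisfy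
`m₀₁ τ² + (m₀₀ − m₁₁) τ − m₁₀ = 0` (then `M_ℂ ω = (m₀₀ + m₀₁ τ) ω`).  [cite: LangeBirkenhake1992, §1.2 Prop. 1.2.3]
[cite: MoonenZarhin1999LowDim, §2 (g = 1)] -/
theorem mem_span_iff_rel (M : (Fin 2 → ℚ) →ₗ[ℚ] (Fin 2 → ℚ)) :
    M.baseChange ℂ ω ∈ ℂ ∙ ω ↔
      (M (Pi.single 1 1) 0 : ℂ) * τ ^ 2 + ((M (Pi.single 0 1) 0 : ℂ) - M (Pi.single 1 1) 1) * τ -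
        M (Pi.single 0 1) 1 = 0 := by
  rw [Submodule.mem_span_singleton]
  constructor
  · rintro ⟨l, hl⟩
    have e0 := congrArg (fun y => piScalarRight ℚ ℂ ℂ (Fin 2) y 0) hl
    have e1 := congrArg (fun y => piScalarRight ℚ ℂ ℂ (Fin 2) y 1) hl
    simp only [coords_smul h0 h1, coords_baseChange h0 h1, Fin.isValue, if_true, one_ne_zero, if_false] at e0 e1
    rw [e0] at e1
    linear_combination e1
  · intro hrel
    refine ⟨(M (Pi.single 0 1) 0 : ℂ) + (M (Pi.single 1 1) 0 : ℂ) * τ, ?_⟩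
    apply (piScalarRight ℚ ℂ ℂ (Fin 2)).injective
    ext j
    rw [coords_smul h0 h1, coords_baseChange h0 h1]
    fin_cases j
    · simp
    · simp only [Fin.mk_one, Fin.isValue, one_ne_zero, if_false]
      linear_combination hrel

include h0 h1 in
/-- **Hom criterion**: a `ℚ`-linear `M` underlies an endomorphism of `V¹_τ` iff
`m₀₁ τ² + (m₀₀ − m₁₁) τ − m₁₀ = 0`. [cite: MoonenZarhin1999LowDim, §2 (g = 1)] [cite: LangeBirkenhake1992, §1.2 Prop. 1.2.3] -/
theorem map_F_le_iff_rel (M : (Fin 2 → ℚ) →ₗ[ℚ] (Fin 2 → ℚ)) :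
    (∀ p : ℤ, ((ofSplitting (ℂ ∙ ω) hP one_pos : HodgeStructure (Fin 2 → ℚ) 1).F p).map (M.baseChange ℂ) ≤
        (ofSplitting (ℂ ∙ ω) hP one_pos : HodgeStructure (Fin 2 → ℚ) 1).F p) ↔
      (M (Pi.single 1 1) 0 : ℂ) * τ ^ 2 + ((M (Pi.single 0 1) 0 : ℂ) - M (Pi.single 1 1) 1) * τ -
        M (Pi.single 0 1) 1 = 0 :=
  (map_F_le_iff_mem_span hP M).trans (mem_span_iff_rel h0 h1 M)

/-- `u + v τ = 0` with `u, v ∈ ℚ` and `τ ∉ ℝ` forces `u = v = 0`. [folklore] -/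
theorem rat_eq_zero_of_add_mul_eq_zero (hτ : τ.im ≠ 0) {u v : ℚ} (h : (u : ℂ) + (v : ℂ) * τ = 0) :
    u = 0 ∧ v = 0 := by
  have him := congrArg Complex.im h
  simp only [Complex.add_im, Complex.ratCast_im, Complex.mul_im, Complex.ratCast_re, zero_add, zero_mul,
    add_zero, Complex.zero_im] at him
  have hv' : v = 0 := by exact_mod_cast (mul_eq_zero.1 him).resolve_right hτ
  refine ⟨?_, hv'⟩
  rw [hv', Rat.cast_zero, zero_mul, add_zero] at h
  exact_mod_cast h

/-! ## §2 The CM endomorphism `M_τ = toLin' (0 1; -q -p)` for `τ² + pτ + q = 0` -/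

/-- `(M_τ v)_0 = v₁`. [folklore] -/
theorem cmMap_apply_zero (p q : ℚ) (v : Fin 2 → ℚ) :
    Matrix.toLin' !![(0 : ℚ), 1; -q, -p] v 0 = v 1 := by
  simp [Matrix.toLin'_apply, Matrix.mulVec, dotProduct, Fin.sum_univ_two]

/-- `(M_τ v)_1 = -q v₀ - p v₁`. [folklore] -/
theorem cmMap_apply_one (p q : ℚ) (v : Fin 2 → ℚ) :
    Matrix.toLin' !![(0 : ℚ), 1; -q, -p] v 1 = -q * v 0 - p * v 1 := by
  simp only [Matrix.toLin'_apply, Matrix.mulVec, dotProduct, Fin.sum_univ_two, Fin.isValue, Matrix.of_apply,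
    Matrix.cons_val', Matrix.cons_val_zero, Matrix.cons_val_one, Matrix.cons_val_fin_one]
  ring

/-- **Cayley–Hamilton for `M_τ`**: `M_τ ∘ M_τ = -p M_τ - q · 1`. [folklore] -/
theorem cmMap_comp_cmMap (p q : ℚ) :
    Matrix.toLin' !![(0 : ℚ), 1; -q, -p] ∘ₗ Matrix.toLin' !![(0 : ℚ), 1; -q, -p] =
      -(p • Matrix.toLin' !![(0 : ℚ), 1; -q, -p]) - q • LinearMap.id := by
  refine LinearMap.ext fun v => funext fun j => ?_
  simp only [LinearMap.comp_apply, LinearMap.sub_apply, LinearMap.neg_apply, LinearMap.smul_apply,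
    LinearMap.id_apply, Pi.sub_apply, Pi.neg_apply, Pi.smul_apply, smul_eq_mul]
  fin_cases j
  · simp only [Fin.zero_eta, Fin.isValue, cmMap_apply_zero, cmMap_apply_one]
    ring
  · simp only [Fin.mk_one, Fin.isValue, cmMap_apply_one, cmMap_apply_zero]
    ring

/-- `M_τ` is not a rational scalar (its `(0,1)` entry is `1`). [folklore] -/
theorem cmMap_ne_smul (p q r : ℚ) : Matrix.toLin' !![(0 : ℚ), 1; -q, -p] ≠ r • LinearMap.id := by
  intro h
  have := congrArg (fun f : (Fin 2 → ℚ) →ₗ[ℚ] (Fin 2 → ℚ) => f (Pi.single 1 1) 0) h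
  simp only [cmMap_apply_zero, LinearMap.smul_apply, LinearMap.id_apply, Pi.smul_apply, smul_eq_mul] at this
  simp at this

variable {p q : ℚ} (hτ2 : τ ^ 2 + p * τ + q = 0)

include h0 h1 hτ2 in
/-- **`(M_τ)_ℂ ω = τ • ω`**: `(M_τ)_ℂ (1, τ) = (τ, -q - pτ) = (τ, τ²) = τ (1, τ)`. [cite: LangeBirkenhake1992, §1.2 Prop. 1.2.3] -/
theorem cmMap_baseChange :
    (Matrix.toLin' !![(0 : ℚ), 1; -q, -p]).baseChange ℂ ω = τ • ω := by
  apply (piScalarRight ℚ ℂ ℂ (Fin 2)).injective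
  ext j
  rw [coords_baseChange h0 h1, coords_smul h0 h1]
  fin_cases j
  · simp [cmMap_apply_zero]
  · simp only [Fin.mk_one, Fin.isValue, one_ne_zero, if_false, cmMap_apply_one, Pi.single_eq_same,
      Pi.single_eq_of_ne (h := one_ne_zero), Pi.single_eq_of_ne (h := zero_ne_one)]
    push_cast
    linear_combination -hτ2

include h0 h1 hτ2 in
/-- **`M_τ` underlies an endomorphism of `V¹_τ`** (it stabilises `F¹ = ℂ ω`). [cite: MoonenZarhin1999LowDim, §2 (2.1) (g = 1), Type IV(1,1)] -/
theorem cmMap_map_F_le (n : ℤ) :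
    ((ofSplitting (ℂ ∙ ω) hP one_pos : HodgeStructure (Fin 2 → ℚ) 1).F n).map
        ((Matrix.toLin' !![(0 : ℚ), 1; -q, -p]).baseChange ℂ) ≤
      (ofSplitting (ℂ ∙ ω) hP one_pos : HodgeStructure (Fin 2 → ℚ) 1).F n :=
  (map_F_le_iff_mem_span hP _).2
    (Submodule.mem_span_singleton.2 ⟨τ, (cmMap_baseChange h0 h1 hτ2).symm⟩) n

include h0 h1 hτ2 in
/-- **For `τ² + pτ + q = 0` the Hodge structure `V¹_τ` has the endomorphism `M_τ`** — complex multiplication by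
`τ`. [cite: MoonenZarhin1999LowDim, §2 (2.1) (g = 1), Type IV(1,1)] [cite: LangeBirkenhake1992, §1.2 Prop. 1.2.3] -/
theorem exists_hom_eq_cmMap :
    ∃ S : Hom (ofSplitting (ℂ ∙ ω) hP one_pos : HodgeStructure (Fin 2 → ℚ) 1) (ofSplitting (ℂ ∙ ω) hP one_pos),
      S.toLinearMap = Matrix.toLin' !![(0 : ℚ), 1; -q, -p] :=
  ⟨⟨_, cmMap_map_F_le h0 h1 hP hτ2⟩, rfl⟩

include h0 h1 hτ2 in
/-- **For `τ² + pτ + q = 0` the Hodge structure `V¹_τ` has a NON-SCALAR endomorphism** (not of Type I(1)).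
[cite: MoonenZarhin1999LowDim, §2 (2.1) (g = 1), Type IV(1,1)] -/
theorem exists_hom_ne_smul :
    ∃ S : Hom (ofSplitting (ℂ ∙ ω) hP one_pos : HodgeStructure (Fin 2 → ℚ) 1) (ofSplitting (ℂ ∙ ω) hP one_pos),
      ∀ r : ℚ, S.toLinearMap ≠ r • LinearMap.id := by
  obtain ⟨S, hS⟩ := exists_hom_eq_cmMap h0 h1 hP hτ2
  exact ⟨S, fun r => by rw [hS]; exact cmMap_ne_smul p q r⟩

/-! ## §3 All endomorphisms of `V¹_τ` for quadratic `τ`: `End(V¹_τ) = ℚ·1 ⊕ ℚ·M_τ ≅ ℚ(τ)` -/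

include h0 h1 hτ2 in
/-- **Every endomorphism of `V¹_τ` (`τ² + pτ + q = 0`, `τ ∉ ℝ`) is `x • 1 + y • M_τ` with `x, y ∈ ℚ`**: after
`τ² = -pτ - q` the criterion reads `(m₀₀ − m₁₁ − p m₀₁) τ = q m₀₁ + m₁₀`, so `m₁₁ = m₀₀ − p m₀₁`, `m₁₀ = −q m₀₁`,
i.e. `M = m₀₀ · 1 + m₀₁ · M_τ`; hence `End(V¹_τ) ≅ ℚ[X]/(X² + pX + q) = ℚ(τ)`.
[cite: MoonenZarhin1999LowDim, §2 (2.1) (g = 1), Type IV(1,1)] [cite: LangeBirkenhake1992, §1.2 Prop. 1.2.3] -/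
theorem hom_eq_smul_add_smul_cmMap (hτ : τ.im ≠ 0)
    (S : Hom (ofSplitting (ℂ ∙ ω) hP one_pos : HodgeStructure (Fin 2 → ℚ) 1) (ofSplitting (ℂ ∙ ω) hP one_pos)) :
    ∃ x y : ℚ, S.toLinearMap = x • LinearMap.id + y • Matrix.toLin' !![(0 : ℚ), 1; -q, -p] := by
  set M := S.toLinearMap with hM
  have hrel := (map_F_le_iff_rel h0 h1 hP M).1 S.map_F_le
  -- substitute `τ² = -pτ - q`
  have hrel' : ((-q * M (Pi.single 1 1) 0 - M (Pi.single 0 1) 1 : ℚ) : ℂ) +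
      ((M (Pi.single 0 1) 0 - M (Pi.single 1 1) 1 - p * M (Pi.single 1 1) 0 : ℚ) : ℂ) * τ = 0 := by
    push_cast
    linear_combination hrel - (M (Pi.single 1 1) 0 : ℂ) * hτ2
  obtain ⟨h10, h11⟩ := rat_eq_zero_of_add_mul_eq_zero hτ hrel'
  refine ⟨M (Pi.single 0 1) 0, M (Pi.single 1 1) 0, ?_⟩
  apply (Pi.basisFun ℚ (Fin 2)).ext
  intro i
  ext j
  simp only [Pi.basisFun_apply, LinearMap.add_apply, LinearMap.smul_apply, LinearMap.id_apply, Pi.add_apply,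
    Pi.smul_apply, smul_eq_mul]
  fin_cases i <;> fin_cases j
  · simp [cmMap_apply_zero]
  · simp only [Fin.mk_one, Fin.isValue, Fin.zero_eta, cmMap_apply_one, Pi.single_eq_same,
      Pi.single_eq_of_ne (h := one_ne_zero), mul_zero, mul_one, sub_zero]
    linear_combination -h10
  · simp [cmMap_apply_zero]
  · simp only [Fin.mk_one, Fin.isValue, cmMap_apply_one, Pi.single_eq_same,
      Pi.single_eq_of_ne (h := zero_ne_one), mul_zero, mul_one, zero_sub]
    linear_combination -h11

include h0 h1 hτ2 in
/-- Conversely every `x • 1 + y • M_τ` stabilises `ℂ ω` (for `τ² + pτ + q = 0`), i.e. underlies an endomorphism of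
`V¹_τ`. [cite: MoonenZarhin1999LowDim, §2 (2.1) (g = 1), Type IV(1,1)] -/
theorem map_F_le_smul_add_smul_cmMap (x y : ℚ) (n : ℤ) :
    ((ofSplitting (ℂ ∙ ω) hP one_pos : HodgeStructure (Fin 2 → ℚ) 1).F n).map
        ((x • LinearMap.id + y • Matrix.toLin' !![(0 : ℚ), 1; -q, -p]).baseChange ℂ) ≤
      (ofSplitting (ℂ ∙ ω) hP one_pos : HodgeStructure (Fin 2 → ℚ) 1).F n := by
  refine (map_F_le_iff_mem_span hP _).2 ?_ n
  rw [LinearMap.baseChange_add, LinearMap.baseChange_smul, LinearMap.baseChange_smul, LinearMap.add_apply,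
    LinearMap.smul_apply, LinearMap.smul_apply, LinearMap.baseChange_id, LinearMap.id_apply]
  refine Submodule.add_mem _ (Submodule.smul_of_tower_mem _ x (Submodule.mem_span_singleton_self _))
    (Submodule.smul_of_tower_mem _ y ?_)
  exact (map_F_le_iff_mem_span hP _).1 (cmMap_map_F_le h0 h1 hP hτ2)

include h0 h1 hτ2 in
/-- **`End(V¹_τ)` is commutative** for quadratic `τ ∉ ℝ` (it is `ℚ[M_τ]`). [cite: MoonenZarhin1999LowDim, §2 (2.1) (g = 1), Type IV(1,1)] -/
theorem hom_comm (hτ : τ.im ≠ 0)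
    (S T : Hom (ofSplitting (ℂ ∙ ω) hP one_pos : HodgeStructure (Fin 2 → ℚ) 1) (ofSplitting (ℂ ∙ ω) hP one_pos)) :
    S.toLinearMap ∘ₗ T.toLinearMap = T.toLinearMap ∘ₗ S.toLinearMap := by
  obtain ⟨x, y, hS⟩ := hom_eq_smul_add_smul_cmMap h0 h1 hP hτ2 hτ S
  obtain ⟨x', y', hT⟩ := hom_eq_smul_add_smul_cmMap h0 h1 hP hτ2 hτ T
  rw [hS, hT]
  simp only [LinearMap.add_comp, LinearMap.comp_add, LinearMap.smul_comp, LinearMap.comp_smul,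
    LinearMap.id_comp, LinearMap.comp_id]
  module

/-! ## §4 Dichotomy: a non-scalar endomorphism exists iff `τ` is quadratic over `ℚ` -/

omit hτ2 in
include h0 h1 in
/-- **`V¹_τ` (`τ ∉ ℝ`) has a non-scalar endomorphism iff `a τ² + b τ + c = 0` for some rationals with `a ≠ 0`**
— Moonen–Zarhin (2.1), `g = 1`: Type IV(1,1) (CM) versus Type I(1) (`End = ℚ`, gen 15's `hom_eq_smul`), decided by
the period (`→`: a non-scalar `M` has `m₀₁ ≠ 0`, as `m₀₁ = 0` forces `m₀₀ = m₁₁`, `m₁₀ = 0`; `←`: `M_τ`, `p = b/a`,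
`q = c/a`). [cite: MoonenZarhin1999LowDim, §2 (2.1) (g = 1)] [cite: SilvermanAEC2009, VI Thm. 5.5] -/
theorem exists_hom_ne_smul_iff (hτ : τ.im ≠ 0) :
    (∃ S : Hom (ofSplitting (ℂ ∙ ω) hP one_pos : HodgeStructure (Fin 2 → ℚ) 1) (ofSplitting (ℂ ∙ ω) hP one_pos),
        ∀ r : ℚ, S.toLinearMap ≠ r • LinearMap.id) ↔
      ∃ a b c : ℚ, a ≠ 0 ∧ (a : ℂ) * τ ^ 2 + b * τ + c = 0 := by
  constructor
  · rintro ⟨S, hS⟩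
    set M := S.toLinearMap with hM
    have hrel := (map_F_le_iff_rel h0 h1 hP M).1 S.map_F_le
    refine ⟨M (Pi.single 1 1) 0, M (Pi.single 0 1) 0 - M (Pi.single 1 1) 1, -M (Pi.single 0 1) 1, ?_, ?_⟩
    · intro h01
      -- then `(m₀₀ - m₁₁) τ - m₁₀ = 0`, so `M` is the scalar `m₀₀`
      have hrel' : ((-M (Pi.single 0 1) 1 : ℚ) : ℂ) + ((M (Pi.single 0 1) 0 - M (Pi.single 1 1) 1 : ℚ) : ℂ) * τ = 0 := by
        push_cast
        have h01' : (M (Pi.single 1 1) 0 : ℂ) = 0 := by exact_mod_cast h01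
        linear_combination hrel - τ ^ 2 * h01'
      obtain ⟨h10, h00⟩ := rat_eq_zero_of_add_mul_eq_zero hτ hrel'
      apply hS (M (Pi.single 0 1) 0)
      apply (Pi.basisFun ℚ (Fin 2)).ext
      intro i
      ext j
      simp only [Pi.basisFun_apply, LinearMap.smul_apply, LinearMap.id_apply, Pi.smul_apply, smul_eq_mul]
      fin_cases i <;> fin_cases j
      · simp
      · simp only [Fin.mk_one, Fin.isValue, Fin.zero_eta, Pi.single_eq_of_ne (h := one_ne_zero), mul_zero]
        linear_combination -h10
      · simpa using h01
      · simp only [Fin.mk_one, Fin.isValue, Pi.single_eq_same, mul_one]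
        linear_combination -h00
    · push_cast
      linear_combination hrel
  · rintro ⟨a, b, c, ha, h⟩
    have hτ2' : τ ^ 2 + (b / a : ℚ) * τ + (c / a : ℚ) = 0 := by
      have ha' : (a : ℂ) ≠ 0 := by exact_mod_cast ha
      push_cast
      field_simp
      linear_combination h
    exact exists_hom_ne_smul h0 h1 hP hτ2'

omit hτ2 in
/-- Normal form of «`τ` satisfies no rational quadratic equation» (gen 15's hypothesis `hq`) versus «no `a ≠ 0`»,
for `τ ∉ ℝ` (a linear relation `bτ + c = 0` is already impossible). [folklore] -/
theorem noQuadratic_iff (hτ : τ.im ≠ 0) :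
    (∀ a b c : ℚ, (a : ℂ) * τ ^ 2 + b * τ + c = 0 → a = 0 ∧ b = 0 ∧ c = 0) ↔
      ¬ ∃ a b c : ℚ, a ≠ 0 ∧ (a : ℂ) * τ ^ 2 + b * τ + c = 0 := by
  refine ⟨fun h ⟨a, b, c, ha, habc⟩ => ha (h a b c habc).1, fun h a b c habc => ?_⟩
  · have ha : a = 0 := by_contra fun ha => h ⟨a, b, c, ha, habc⟩
    rw [ha, Rat.cast_zero, zero_mul, zero_add] at habc
    obtain ⟨hc, hb⟩ := rat_eq_zero_of_add_mul_eq_zero hτ (show (c : ℂ) + (b : ℂ) * τ = 0 by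
      rw [mul_comm] at habc; linear_combination habc)
    exact ⟨ha, hb, hc⟩

omit hτ2 in
include h0 h1 in
/-- **`End(V¹_τ) = ℚ` iff `τ` satisfies no rational quadratic equation** (`τ ∉ ℝ`): the converse of gen 15's
`hom_eq_smul` joined to `exists_hom_ne_smul_iff`. [cite: MoonenZarhin1999LowDim, §2 (2.1) (g = 1)] -/
theorem forall_hom_eq_smul_iff (hτ : τ.im ≠ 0) :
    (∀ S : Hom (ofSplitting (ℂ ∙ ω) hP one_pos : HodgeStructure (Fin 2 → ℚ) 1) (ofSplitting (ℂ ∙ ω) hP one_pos),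
        ∃ r : ℚ, S.toLinearMap = r • LinearMap.id) ↔
      ∀ a b c : ℚ, (a : ℂ) * τ ^ 2 + b * τ + c = 0 → a = 0 ∧ b = 0 ∧ c = 0 := by
  rw [noQuadratic_iff hτ, ← exists_hom_ne_smul_iff h0 h1 hP hτ]
  simp only [not_exists, not_forall, not_not]

end Period

/-! ## §5 Exports at the level of `τ` -/

/-- **For `Im τ > 0` with `τ² + pτ + q = 0` (`p, q ∈ ℚ`) there is a polarisable, effective weight-one `ℚ`-Hodge
structure on `ℚ²` — `V¹_τ` — whose endomorphisms are EXACTLY the `x • 1 + y • M_τ`, `M_τ = toLin' (0 1; -q -p)`,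
`x, y ∈ ℚ`**: `End(V¹_τ) ≅ ℚ(τ)`, complex multiplication by the imaginary quadratic field `ℚ(τ)` (Moonen–Zarhin
Type IV(1,1)). [cite: MoonenZarhin1999LowDim, §2 (2.1) (g = 1), Type IV(1,1)] [cite: LangeBirkenhake1992, §1.2 and Thm. 4.2.1] -/
theorem exists_weightOne_rankTwo_cm_of {τ : ℂ} (hτ' : 0 < τ.im) {p q : ℚ} (hτ2 : τ ^ 2 + p * τ + q = 0) :
    ∃ H : HodgeStructure (Fin 2 → ℚ) 1, H.IsPolarizable ∧ H.IsEffective ∧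
      (∃ S : Hom H H, S.toLinearMap = Matrix.toLin' !![(0 : ℚ), 1; -q, -p]) ∧
      ∀ S : Hom H H, ∃ x y : ℚ, S.toLinearMap = x • LinearMap.id + y • Matrix.toLin' !![(0 : ℚ), 1; -q, -p] := by
  have h0 : piScalarRight ℚ ℂ ℂ (Fin 2) ((1 : ℂ) ⊗ₜ[ℚ] (Pi.single 0 1 : Fin 2 → ℚ) + τ ⊗ₜ[ℚ] Pi.single 1 1) 0 = 1 := by
    rw [map_add, Pi.add_apply, coords_tmul, coords_tmul]
    simp
  have h1 : piScalarRight ℚ ℂ ℂ (Fin 2) ((1 : ℂ) ⊗ₜ[ℚ] (Pi.single 0 1 : Fin 2 → ℚ) + τ ⊗ₜ[ℚ] Pi.single 1 1) 1 = τ := by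
    rw [map_add, Pi.add_apply, coords_tmul, coords_tmul]
    simp
  exact ⟨ofSplitting _ (isCompl_span h0 h1 hτ'.ne') one_pos, isPolarizable h0 h1 _ hτ', isEffective _,
    exists_hom_eq_cmMap h0 h1 _ hτ2, hom_eq_smul_add_smul_cmMap h0 h1 _ hτ2 hτ'.ne'⟩

/-- **The period `τ = i√d`, `d > 0` rational: `V¹_{i√d}` has complex multiplication by `ℚ(√-d)`** — its
endomorphisms are exactly the `x • 1 + y • M`, `M = toLin' (0 1; -d 0)`, `M² = -d` (the `H¹` of `ℂ/(ℤ + ℤ√-d)`).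
[cite: MoonenZarhin1999LowDim, §2 (2.1) (g = 1), Type IV(1,1)] [cite: SilvermanAEC2009, VI Thm. 5.5] -/
theorem exists_weightOne_rankTwo_cm_sqrt_neg {d : ℚ} (hd : 0 < d) :
    ∃ H : HodgeStructure (Fin 2 → ℚ) 1, H.IsPolarizable ∧ H.IsEffective ∧
      (∃ S : Hom H H, S.toLinearMap = Matrix.toLin' !![(0 : ℚ), 1; -d, 0]) ∧
      ∀ S : Hom H H, ∃ x y : ℚ, S.toLinearMap = x • LinearMap.id + y • Matrix.toLin' !![(0 : ℚ), 1; -d, 0] := by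
  have hτ' : 0 < (Complex.I * Real.sqrt d).im := by
    simpa using Real.sqrt_pos.2 (show (0 : ℝ) < d by exact_mod_cast hd)
  have hτ2 : (Complex.I * Real.sqrt d) ^ 2 + ((0 : ℚ) : ℂ) * (Complex.I * Real.sqrt d) + ((d : ℚ) : ℂ) = 0 := by
    have hsq : ((Real.sqrt d : ℝ) : ℂ) ^ 2 = (d : ℂ) := by
      rw [← Complex.ofReal_pow, Real.sq_sqrt (by exact_mod_cast hd.le)]
      simp
    rw [mul_pow, Complex.I_sq, hsq]
    push_cast
    ring
  obtain ⟨H, hpol, heff, hS, hall⟩ := exists_weightOne_rankTwo_cm_of hτ' hτ2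
  rw [neg_zero] at hS hall
  exact ⟨H, hpol, heff, hS, hall⟩

end Summit.HodgeConjecture.CorCM.PeriodHodgeStructure

end
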